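import Mathlib
import HarnessLib
import Summits.NavierStokesRegularity.NavierStokesRegularity.Theorems.PoloidalWindowDoorLrcModEntireThreadQuarticPin
import Summits.NavierStokesRegularity.NavierStokesRegularity.Theorems.PoloidalWindowDoorLrcModEntireQuarticMax

/-!
# Route `PoloidalWindowDoor`, item `LrcModEntire` (stmt-NavierStokesRegularity-20428) / crux K2 (stmt-19708) —
# the HIGHER-ORDER MAXIMUM TEST at every order, and the pins of the doubly-degenerate flat residue

LEAD of item 20428 ns-poloidal-K2-p3 g10 (`--supports stmt-NavierStokesRegularity-20428 --as helper`).
`…ThreadQuarticPin` proved the one-variable test at orders 3 and 4.  This file proves it at EVERY order: if `φ ∈ Cⁿ` (`n ≥ 1`) has a local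
maximum at `0` and `φ^{(k)}(0) = 0` for `1 ≤ k < n`, then `φ^{(n)}(0) ≤ 0`, and `= 0` when `n` is odd (`higherOrderMaxTest_nonpos`,
`higherOrderMaxTest_odd`; engine: the sign lemma `eventually_nhdsWithin_sign_eq_of_deriv_pos` + the mean value theorem, descending induction
on the order).  Consequence for the doubly-degenerate flat residue of thread_axis S3′ (THICK-COLUMN-g10 §4(b)): at a threaded hot spot, along a
direction `e` whose line jet of `v₂(−1,·)` vanishes at orders `2 … n−1`, `V·Dⁿv₂(−1,·)(0)[e,…,e] ≤ 0` and `= 0` for odd `n` (`threadLinePin`).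
WHAT THIS IS NOT: not S3′, not a claim about Navier–Stokes regularity — calculus (bears_on LADDER-NS N0, rung N0-LocalTubeDoorPoloidal). [folklore]
-/

noncomputable section

-- the summit and its single sub-problem share the name (CONVENTIONS §1), as in every Theorems file
set_option linter.dupNamespace false

namespace Summit.NavierStokesRegularity.NavierStokesRegularity.Theorems.PoloidalWindowDoorLrcModEntireHigherOrderMaxTest

open MeasureTheory Set Function Filter Topology
open scoped RealInnerProductSpace InnerProductSpace
open Literature.Analysis Literature.Analysis.FluidPDE Literature.Analysis.UnboundedOperators
open Summit.NavierStokesRegularity.NavierStokesRegularity.Theorems.LocalSineTubeDoorProfileAlignedWindowRigidityAncient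
open Summit.NavierStokesRegularity.NavierStokesRegularity.Theorems.PoloidalWindowDoorLrcModEntireThreadQuarticPin
open Summit.NavierStokesRegularity.NavierStokesRegularity.Theorems.PoloidalWindowDoorLrcModEntireQuarticMax

/-! ### The one-variable test at every order -/

/-- Propagation engine: if `φ ∈ Cⁿ`, `k < n` and `φ^{(k+1)} > 0` on `(0,ε)`, then `φ^{(k)}(0) < φ^{(k)}(x)` on `(0,ε)`. [folklore] -/
theorem iteratedDeriv_lt_of_succ_pos {φ : ℝ → ℝ} {n : ℕ} (hφ : ContDiff ℝ n φ) {k : ℕ} (hk : k < n) {ε : ℝ}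
    (hpos : ∀ x : ℝ, 0 < x → x < ε → 0 < iteratedDeriv (k + 1) φ x) :
    ∀ x : ℝ, 0 < x → x < ε → iteratedDeriv k φ 0 < iteratedDeriv k φ x := by
  have hd : Differentiable ℝ (iteratedDeriv k φ) := hφ.differentiable_iteratedDeriv k (by exact_mod_cast hk)
  refine lt_of_deriv_pos_Ioo hd fun x hx hxε => ?_
  rw [← iteratedDeriv_succ]
  exact hpos x hx hxε

/-- No `Cⁿ` function with a local maximum at `0`, vanishing derivatives of orders `1 … n−1` at `0` and POSITIVE `n`-th derivative at `0`.
[folklore] -/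
theorem not_pos_of_isLocalMax {φ : ℝ → ℝ} {n : ℕ} (hφ : ContDiff ℝ n φ) (hn : 1 ≤ n) (hmax : IsLocalMax φ 0)
    (hvan : ∀ k : ℕ, 1 ≤ k → k < n → iteratedDeriv k φ 0 = 0) : ¬ 0 < iteratedDeriv n φ 0 := by
  intro hpos
  rcases Nat.lt_or_ge n 2 with hn1 | hn2
  · -- `n = 1`: `φ'(0) = 0` at a local maximum
    have hn' : n = 1 := by omega
    subst hn'
    rw [iteratedDeriv_one, hmax.deriv_eq_zero] at hpos
    exact lt_irrefl _ hpos
  · -- `n ≥ 2`: sign lemma on `φ^{(n−1)}`, then descend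
    obtain ⟨m, rfl⟩ : ∃ m, n = m + 2 := ⟨n - 2, by omega⟩
    have hf0 : iteratedDeriv (m + 1) φ 0 = 0 := hvan (m + 1) (by omega) (by omega)
    have hderiv : 0 < deriv (iteratedDeriv (m + 1) φ) 0 := by
      rw [← iteratedDeriv_succ]; exact hpos
    have hsign := eventually_nhdsWithin_sign_eq_of_deriv_pos hderiv hf0
    obtain ⟨ε, hε, hball⟩ := Metric.eventually_nhds_iff.1 (hsign.and hmax)
    have htop : ∀ x : ℝ, 0 < x → x < ε → 0 < iteratedDeriv (m + 1) φ x := by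
      intro x hx0 hxε
      have hx : dist x 0 < ε := by rw [Real.dist_eq, sub_zero, abs_of_pos hx0]; exact hxε
      have h := (hball hx).1
      rw [sub_zero, sign_pos hx0, sign_eq_one_iff] at h
      exact h
    -- descending induction: `φ^{(k)} > 0` on `(0,ε)` for `1 ≤ k ≤ m+1`
    have hdesc : ∀ d k : ℕ, k + d = m + 1 → 1 ≤ k → ∀ x : ℝ, 0 < x → x < ε → 0 < iteratedDeriv k φ x := by
      intro d
      induction d with
      | zero =>
          intro k hk hk1 x hx hxε
          rw [add_zero] at hk
          rw [hk]; exact htop x hx hxε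
      | succ d ih =>
          intro k hk hk1 x hx hxε
          have hk' : (k + 1) + d = m + 1 := by omega
          have hup := ih (k + 1) hk' (by omega)
          have hlt := iteratedDeriv_lt_of_succ_pos hφ (k := k) (by exact_mod_cast (by omega : k < m + 2)) hup x hx hxε
          rw [hvan k hk1 (by omega)] at hlt
          exact hlt
    have h1 : ∀ x : ℝ, 0 < x → x < ε → 0 < iteratedDeriv 1 φ x := hdesc m 1 (by omega) le_rfl
    have h0 : ∀ x : ℝ, 0 < x → x < ε → iteratedDeriv 0 φ 0 < iteratedDeriv 0 φ x :=
      iteratedDeriv_lt_of_succ_pos hφ (k := 0) (by exact_mod_cast (by omega : 0 < m + 2)) h1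
    have hε2 : dist (ε / 2) 0 < ε := by rw [Real.dist_eq, sub_zero, abs_of_pos (by linarith)]; linarith
    have hle : φ (ε / 2) ≤ φ 0 := (hball hε2).2
    have hlt := h0 (ε / 2) (by linarith) (by linarith)
    rw [iteratedDeriv_zero] at hlt
    linarith

/-- **HIGHER-ORDER MAXIMUM TEST (sign).**  `φ ∈ Cⁿ`, `n ≥ 1`, local maximum at `0`, `φ^{(k)}(0) = 0` for `1 ≤ k < n` ⇒ `φ^{(n)}(0) ≤ 0`. [folklore] -/
theorem higherOrderMaxTest_nonpos {φ : ℝ → ℝ} {n : ℕ} (hφ : ContDiff ℝ n φ) (hn : 1 ≤ n) (hmax : IsLocalMax φ 0)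
    (hvan : ∀ k : ℕ, 1 ≤ k → k < n → iteratedDeriv k φ 0 = 0) : iteratedDeriv n φ 0 ≤ 0 :=
  not_lt.1 (not_pos_of_isLocalMax hφ hn hmax hvan)

/-- **HIGHER-ORDER MAXIMUM TEST (odd orders vanish).**  Under the same hypotheses with `n` odd, `φ^{(n)}(0) = 0` (apply the sign test to
`φ` and to `x ↦ φ(−x)`). [folklore] -/
theorem higherOrderMaxTest_odd {φ : ℝ → ℝ} {n : ℕ} (hφ : ContDiff ℝ n φ) (hn : Odd n) (hmax : IsLocalMax φ 0)
    (hvan : ∀ k : ℕ, 1 ≤ k → k < n → iteratedDeriv k φ 0 = 0) : iteratedDeriv n φ 0 = 0 := by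
  have hn1 : 1 ≤ n := by obtain ⟨j, rfl⟩ := hn; omega
  have h1 := higherOrderMaxTest_nonpos hφ hn1 hmax hvan
  -- the reflected function
  set ψ : ℝ → ℝ := fun x => φ (-x) with hψ
  have hψc : ContDiff ℝ n ψ := hφ.comp contDiff_neg
  have hψmax : IsLocalMax ψ 0 := by
    have h : IsLocalMax (φ ∘ Neg.neg) (0 : ℝ) :=
      IsLocalMax.comp_continuous (by simpa using hmax) continuous_neg.continuousAt
    exact h
  have hψvan : ∀ k : ℕ, 1 ≤ k → k < n → iteratedDeriv k ψ 0 = 0 := by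
    intro k hk1 hkn
    rw [hψ, iteratedDeriv_comp_neg k φ 0, neg_zero, hvan k hk1 hkn, smul_zero]
  have h2 := higherOrderMaxTest_nonpos hψc hn1 hψmax hψvan
  rw [hψ, iteratedDeriv_comp_neg n φ 0, neg_zero, hn.neg_one_pow, smul_eq_mul] at h2
  linarith

/-! ### The class corollary: line pins of every order at the hot spot -/

section Class

variable {v : ℝ → EuclideanSpace ℝ (Fin 3) → EuclideanSpace ℝ (Fin 3)} {C : ℝ}

/-- **LINE PINS OF EVERY ORDER at a threaded hot spot.**  For a profile of the class whose scale-invariant vertical size peaks at `(−1,0)` with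
`V := v₂(−1,0) ≠ 0`, a direction `e`, and an order `n ≥ 2` such that the line jet `Dᵏv₂(−1,·)(0)[e,…,e]` vanishes for `2 ≤ k < n`:
`V·Dⁿv₂(−1,·)(0)[e,…,e] ≤ 0`, and `Dⁿv₂(−1,·)(0)[e,…,e] = 0` if `n` is odd (order 1 is the thread pin, free). [folklore] -/
theorem threadLinePin (hrate : HasTypeITimeDecay C v) (hcont : ContinuousOn (uncurry v) (Iio (0 : ℝ) ×ˢ univ))
    (hmild : ∀ s t : ℝ, s < t → t < 0 → ∀ x, v t x = heatExtension (v s) (t - s) x - oseenDuhamel 1 s v v t x)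
    (hne : v (-1) 0 2 ≠ 0) (hhot : ∀ t < 0, ∀ x, Real.sqrt (-t) * |v t x 2| ≤ |v (-1) 0 2|) (e : EuclideanSpace ℝ (Fin 3))
    {n : ℕ} (hn : 2 ≤ n) (hvan : ∀ k : ℕ, 2 ≤ k → k < n → iteratedFDeriv ℝ k (fun y => v (-1) y 2) 0 (fun _ => e) = 0) :
    v (-1) 0 2 * iteratedFDeriv ℝ n (fun y => v (-1) y 2) 0 (fun _ => e) ≤ 0 ∧
      (Odd n → iteratedFDeriv ℝ n (fun y => v (-1) y 2) 0 (fun _ => e) = 0) := by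
  set f : EuclideanSpace ℝ (Fin 3) → ℝ := fun y => v (-1) y 2 with hf
  have hsl := analyticOnNhd_slice hcont (bdd_of_hasTypeITimeDecay hrate) hmild (by norm_num : (-1 : ℝ) < 0)
  have hfa : ContDiff ℝ n f := by
    have han : AnalyticOnNhd ℝ f univ := fun y _ =>
      ((EuclideanSpace.proj (𝕜 := ℝ) (2 : Fin 3)).analyticAt _).comp (hsl y (mem_univ _))
    exact han.contDiff
  obtain ⟨σ, hσabs, hσa⟩ : ∃ σ : ℝ, |σ| = 1 ∧ σ * v (-1) 0 2 = |v (-1) 0 2| := by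
    rcases lt_or_gt_of_ne hne with h | h
    · exact ⟨-1, by simp, by rw [abs_of_neg h]; ring⟩
    · exact ⟨1, by simp, by rw [abs_of_pos h]; ring⟩
  have hσle : ∀ y : ℝ, σ * y ≤ |y| := fun y =>
    calc σ * y ≤ |σ * y| := le_abs_self _
      _ = |y| := by rw [abs_mul, hσabs, one_mul]
  have hσne : σ ≠ 0 := fun h => by rw [h, abs_zero] at hσabs; exact zero_ne_one hσabs
  have hσ2 : σ * σ = 1 := by
    have h := congrArg (fun r : ℝ => r ^ 2) hσabs
    simp only [sq_abs, one_pow] at h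
    nlinarith [h]
  -- the line function `φ(t) = σ f(t e)`
  set g : ℝ → ℝ := fun t => f (t • e) with hg
  have hgc : ContDiff ℝ n g := hfa.comp (contDiff_id.smul contDiff_const)
  set φ : ℝ → ℝ := fun t => σ * g t with hφ
  have hφc : ContDiff ℝ n φ := contDiff_const.mul hgc
  have hmax : IsLocalMax φ 0 := by
    refine Filter.Eventually.of_forall fun t => ?_
    show σ * f (t • e) ≤ σ * f ((0 : ℝ) • e)
    simp only [zero_smul]
    have hh := hhot (-1) (by norm_num) (t • e)
    have hR : Real.sqrt (-(-1 : ℝ)) = 1 := by norm_num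
    rw [hR, one_mul] at hh
    calc σ * f (t • e) ≤ |f (t • e)| := hσle _
      _ ≤ |v (-1) 0 2| := hh
      _ = σ * f 0 := hσa.symm
  have hder : ∀ k : ℕ, k ≤ n → iteratedDeriv k φ 0 = σ * iteratedFDeriv ℝ k f 0 (fun _ => e) := by
    intro k hk
    have h1 : iteratedDeriv k φ 0 = σ * iteratedDeriv k g 0 := by
      have hφ' : φ = σ • g := by funext t; simp [hφ, smul_eq_mul]
      rw [hφ', iteratedDeriv_const_smul ((hgc.of_le (by exact_mod_cast hk)).contDiffAt) σ, smul_eq_mul]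
    rw [h1, hg, iteratedDeriv_line hfa e hk]
  -- order 1 is the thread pin
  have hpin1 : iteratedFDeriv ℝ 1 f 0 (fun _ => e) = 0 := by
    rw [iteratedFDeriv_one_apply, hf, PoloidalWindowDoorLrcModEntireThreadPins.fderiv_apply_coord (v (-1)) ((hsl 0 (mem_univ _)).differentiableAt) e 2]
    exact PoloidalWindowDoorLrcModEntireThreadPins.threadPin_of_hotSpot hrate hcont hmild hhot e
  have hvanφ : ∀ k : ℕ, 1 ≤ k → k < n → iteratedDeriv k φ 0 = 0 := by
    intro k hk1 hkn
    rw [hder k hkn.le]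
    rcases Nat.lt_or_ge k 2 with hk2 | hk2
    · have : k = 1 := by omega
      subst this; rw [hpin1, mul_zero]
    · rw [hvan k hk2 hkn, mul_zero]
  have hA := higherOrderMaxTest_nonpos hφc (by omega) hmax hvanφ
  rw [hder n le_rfl] at hA
  have haσ : v (-1) 0 2 = |v (-1) 0 2| * σ := by
    calc v (-1) 0 2 = (σ * σ) * v (-1) 0 2 := by rw [hσ2, one_mul]
      _ = (σ * v (-1) 0 2) * σ := by ring
      _ = |v (-1) 0 2| * σ := by rw [hσa]
  refine ⟨?_, fun hodd => ?_⟩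
  · rw [haσ, mul_assoc]
    exact mul_nonpos_of_nonneg_of_nonpos (abs_nonneg _) hA
  · have hB := higherOrderMaxTest_odd hφc hodd hmax hvanφ
    rw [hder n le_rfl] at hB
    exact (mul_eq_zero.1 hB).resolve_left hσne

end Class

end Summit.NavierStokesRegularity.NavierStokesRegularity.Theorems.PoloidalWindowDoorLrcModEntireHigherOrderMaxTest
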